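import Mathlib.RepresentationTheory.Homological.GroupCohomology.LowDegree
import Mathlib.Topology.AlexandrovDiscrete
import Literature.NumberTheory.GaloisRepresentations.ContinuousH2
import HarnessLib

/-!
# For a discrete group, Mathlib's `groupCohomology.H2` IS Mathlib's `continuousCohomology 2`

Topic `NumberTheory/GaloisRepresentations`; namespace `Literature.NumberTheory.GaloisRepresentations`.
The degree-two twin of `ContinuousH1DiscreteGroup.lean`: generic glue between the two second-cohomology
groups Mathlib offers for a group `K` acting on a module `M`,

* `groupCohomology.H2 (Rep.of ρ)` — homology of the INHOMOGENEOUS cochains of the `k`-linear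
  representation `ρ : Representation k K M` (abstract group, no topology), with the cocycle API
  `cocycles₂`, `H2π`, `H2π_eq_zero_iff`, `H2_induction_on`;
* `continuousCohomology 2 (TopRep.of π)` — homology of the continuous HOMOGENEOUS cochains of a
  continuous realisation `π : ContRepresentation k K M` of the same action on a topological module
  `M`, with the tree's inhomogeneous-cocycle API of `ContinuousH2.lean` (`contTwoCocycles`,
  `twoCocycleClass`, `_surjective`, `_eq_zero_iff`).

When `K` carries the DISCRETE topology every inhomogeneous `2`-cocycle `K × K → M` is continuous, and the
two groups coincide: `H2DiscreteEquiv ρ π hπ : groupCohomology.H2 (Rep.of ρ) ≃ₗ[k] continuousCohomology 2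
(TopRep.of π)`, characterised by `H2DiscreteEquiv_H2π : [f] ↦ twoCocycleClass f` (both are "continuous
factor systems modulo coboundaries of `1`-cochains", Serre, *Galois Cohomology*, I §2.2–§2.3
[cite: SerreGaloisCohomology1997, I §2.3]; Neukirch–Schmidt–Wingberg (1.2), II §7
[cite: NeukirchSchmidtWingberg2008, I §2 and II §7]).

This is the first half of the bridge from the finite-group engine `Literature/Algebra/Homology` (class
modules, Tate's theorem, on Mathlib `groupCohomology` of `Rep k G`, `G` finite) to the tree's continuous
Galois cohomology (`galoisCohomology`, `galoisCohomology.inf` from the finite discrete quotients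
`Γ_K ⧸ Gal(K̄/L) ≅ Gal(L/K)`): a fundamental class `u_{L/K} ∈ H²(Gal(L/K), Lˣ)` of the engine becomes a
class of `H²_cont(Gal(L/K), Lˣ)` and can then be inflated to `H²(Γ_K, K̄ˣ)`.  Written for the
bsd-schneider cell (crux `AnticycControlAdditiveK`, Route A towards Poitou–Tate).  Everything is
definitional / proved; no named facts.
-/

noncomputable section

open CategoryTheory groupCohomology

namespace Literature.NumberTheory.GaloisRepresentations

universe u

variable {k : Type u} [CommRing k] [TopologicalSpace k]
  {K : Type u} [Group K] [TopologicalSpace K] [DiscreteTopology K]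
  {M : Type u} [AddCommGroup M] [Module k M] [TopologicalSpace M] [IsTopologicalAddGroup M]
  [ContinuousSMul k M]
  (ρ : Representation k K M) (π : ContRepresentation k K M) (hπ : ∀ g x, π g x = ρ g x)

/-! ### Cocycles: inhomogeneous `2`-cocycles are continuous factor systems -/

/-- An inhomogeneous `2`-cocycle `f : K × K → M` of `Rep.of ρ` is a continuous inhomogeneous `2`-cocycle
of `TopRep.of π` (`K` discrete). [cite: SerreGaloisCohomology1997, I §2.3] -/
def cocycles₂ToContTwoCocycles : cocycles₂ (Rep.of ρ) →ₗ[k] contTwoCocycles (TopRep.of π) where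
  toFun f := ⟨⟨(f : K × K → M), continuous_of_discreteTopology⟩, fun σ τ υ => by
    change π σ ((f : K × K → M) (τ, υ)) + (f : K × K → M) (σ, τ * υ) =
      (f : K × K → M) (σ * τ, υ) + (f : K × K → M) (σ, τ)
    rw [hπ]
    exact ((mem_cocycles₂_iff (A := Rep.of ρ) (f : K × K → M)).1 f.2 σ τ υ).symm⟩
  map_add' f g := Subtype.ext (ContinuousMap.ext fun x => rfl)
  map_smul' c f := Subtype.ext (ContinuousMap.ext fun x => rfl)

/-- `cocycles₂ToContTwoCocycles f` is `f` as a function. [cite: SerreGaloisCohomology1997, I §2.3] -/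
@[simp] theorem cocycles₂ToContTwoCocycles_apply (f : cocycles₂ (Rep.of ρ)) (p : K × K) :
    (cocycles₂ToContTwoCocycles ρ π hπ f).1 p = (f : K × K → M) p := rfl

/-- Conversely a continuous inhomogeneous `2`-cocycle of `TopRep.of π` is an inhomogeneous `2`-cocycle of
`Rep.of ρ`. [cite: SerreGaloisCohomology1997, I §2.3] -/
def contTwoCocyclesToCocycles₂ (c : contTwoCocycles (TopRep.of π)) : cocycles₂ (Rep.of ρ) :=
  ⟨fun p => c.1 p, (mem_cocycles₂_iff (A := Rep.of ρ) _).2 fun σ τ υ => by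
    change c.1 (σ * τ, υ) + c.1 (σ, τ) = ρ σ (c.1 (τ, υ)) + c.1 (σ, τ * υ)
    rw [← hπ]
    exact (c.2 σ τ υ).symm⟩

/-- The two dictionaries are inverse to each other (one direction).
[cite: SerreGaloisCohomology1997, I §2.3] -/
@[simp] theorem cocycles₂ToContTwoCocycles_contTwoCocyclesToCocycles₂
    (c : contTwoCocycles (TopRep.of π)) :
    cocycles₂ToContTwoCocycles ρ π hπ (contTwoCocyclesToCocycles₂ ρ π hπ c) = c :=
  Subtype.ext (ContinuousMap.ext fun _ => rfl)

/-! ### The class map on cocycles and its descent to `H²` -/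

/-- `f ↦ [f]_cont`: an inhomogeneous `2`-cocycle to the class of the corresponding continuous factor
system in `continuousCohomology 2`. [cite: SerreGaloisCohomology1997, I §2.3] -/
def cocycles₂ToContinuousCohomology :
    cocycles₂ (Rep.of ρ) →ₗ[k] continuousCohomology 2 (TopRep.of π) :=
  (twoCocycleClassₗ (TopRep.of π)).comp (cocycles₂ToContTwoCocycles ρ π hπ)

/-- Unfolding `cocycles₂ToContinuousCohomology`. [cite: SerreGaloisCohomology1997, I §2.3] -/
@[simp] theorem cocycles₂ToContinuousCohomology_apply (f : cocycles₂ (Rep.of ρ)) :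
    cocycles₂ToContinuousCohomology ρ π hπ f =
      twoCocycleClass (TopRep.of π) (cocycles₂ToContTwoCocycles ρ π hπ f) := rfl

/-- A coboundary `(g, h) ↦ g • x(h) - x(gh) + x(g)` has zero class in `continuousCohomology 2` (it is the
coboundary of the CONTINUOUS `1`-cochain `x`, `K` discrete). [cite: SerreGaloisCohomology1997, I §2.3] -/
theorem cocycles₂ToContinuousCohomology_eq_zero_of_mem (f : cocycles₂ (Rep.of ρ))
    (hf : (f : K × K → M) ∈ coboundaries₂ (Rep.of ρ)) :
    cocycles₂ToContinuousCohomology ρ π hπ f = 0 := by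
  obtain ⟨x, hx⟩ := hf
  rw [cocycles₂ToContinuousCohomology_apply, twoCocycleClass_eq_zero_iff]
  refine ⟨⟨x, continuous_of_discreteTopology⟩, fun σ τ => ?_⟩
  rw [cocycles₂ToContTwoCocycles_apply, ← hx, d₁₂_hom_apply]
  change ρ σ (x τ) - x (σ * τ) + x σ = π σ (x τ) - x (σ * τ) + x σ
  rw [hπ]

/-- The explicit-quotient model `Z²/B²` of `H²` that Mathlib exposes through `groupCohomology.H2Iso`
maps to `continuousCohomology 2`: the descent of `cocycles₂ToContinuousCohomology` to the quotient by
the coboundaries. [cite: SerreGaloisCohomology1997, I §2.3] -/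
def quotientToContinuousCohomology₂ :
    (shortComplexH2 (Rep.of ρ)).moduleCatLeftHomologyData.H →ₗ[k]
      continuousCohomology 2 (TopRep.of π) :=
  (LinearMap.range (shortComplexH2 (Rep.of ρ)).moduleCatToCycles).liftQ
    (cocycles₂ToContinuousCohomology ρ π hπ) (by
      rintro f ⟨a, rfl⟩
      rw [LinearMap.mem_ker]
      apply cocycles₂ToContinuousCohomology_eq_zero_of_mem
      exact ⟨a, rfl⟩)

/-- **The comparison map** `H²(K, Rep.of ρ) → H²_cont(K, TopRep.of π)` (Mathlib inhomogeneous `H2` to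
Mathlib continuous `H²`), `K` discrete. [cite: SerreGaloisCohomology1997, I §2.3] -/
def H2ToContinuousCohomology : groupCohomology.H2 (Rep.of ρ) →ₗ[k] continuousCohomology 2 (TopRep.of π) :=
  (quotientToContinuousCohomology₂ ρ π hπ).comp (H2Iso (Rep.of ρ)).hom.hom

/-- **On classes of cocycles, the comparison map is `[f] ↦ [f]`.** [cite: SerreGaloisCohomology1997, I §2.3] -/
theorem H2ToContinuousCohomology_H2π (f : cocycles₂ (Rep.of ρ)) :
    H2ToContinuousCohomology ρ π hπ (H2π (Rep.of ρ) f) =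
      twoCocycleClass (TopRep.of π) (cocycles₂ToContTwoCocycles ρ π hπ f) := by
  have h1 : (H2Iso (Rep.of ρ)).hom (H2π (Rep.of ρ) f) =
      (shortComplexH2 (Rep.of ρ)).moduleCatLeftHomologyData.π f := by
    change (H2Iso (Rep.of ρ)).hom (groupCohomology.π (Rep.of ρ) 2 ((isoCocycles₂ (Rep.of ρ)).inv f)) = _
    rw [π_comp_H2Iso_hom_apply, Iso.inv_hom_id_apply]
    rfl
  change quotientToContinuousCohomology₂ ρ π hπ ((H2Iso (Rep.of ρ)).hom (H2π (Rep.of ρ) f)) = _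
  rw [h1]
  rfl

/-- The comparison map is injective: a cocycle that is the coboundary of a CONTINUOUS `1`-cochain is a
coboundary. [cite: SerreGaloisCohomology1997, I §2.3] -/
theorem H2ToContinuousCohomology_injective :
    Function.Injective (H2ToContinuousCohomology ρ π hπ) := by
  refine (injective_iff_map_eq_zero _).2 fun x hx => ?_
  induction x using H2_induction_on with
  | h f =>
    rw [H2ToContinuousCohomology_H2π, twoCocycleClass_eq_zero_iff] at hx
    obtain ⟨b, hb⟩ := hx
    refine (H2π_eq_zero_iff f).2 ⟨fun g => b g, funext fun p => ?_⟩
    obtain ⟨σ, τ⟩ := p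
    have hg := hb σ τ
    rw [cocycles₂ToContTwoCocycles_apply] at hg
    rw [d₁₂_hom_apply, hg]
    change ρ σ (b τ) - b (σ * τ) + b σ = π σ (b τ) - b (σ * τ) + b σ
    rw [hπ]

/-- The comparison map is surjective: every continuous factor system of the discrete `K` is an
inhomogeneous cocycle. [cite: SerreGaloisCohomology1997, I §2.3] -/
theorem H2ToContinuousCohomology_surjective :
    Function.Surjective (H2ToContinuousCohomology ρ π hπ) := by
  intro y
  obtain ⟨c, rfl⟩ := twoCocycleClass_surjective (TopRep.of π) y
  refine ⟨H2π (Rep.of ρ) (contTwoCocyclesToCocycles₂ ρ π hπ c), ?_⟩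
  rw [H2ToContinuousCohomology_H2π, cocycles₂ToContTwoCocycles_contTwoCocyclesToCocycles₂]

/-- **`H²(K, M) ≅ H²_cont(K, M)` for a discrete group `K`** — Mathlib's inhomogeneous group cohomology
of `Rep.of ρ` and Mathlib's continuous cohomology of the continuous realisation `TopRep.of π` agree in
degree two, as `k`-modules. [cite: SerreGaloisCohomology1997, I §2.3] -/
def H2DiscreteEquiv : groupCohomology.H2 (Rep.of ρ) ≃ₗ[k] continuousCohomology 2 (TopRep.of π) :=
  LinearEquiv.ofBijective (H2ToContinuousCohomology ρ π hπ)
    ⟨H2ToContinuousCohomology_injective ρ π hπ, H2ToContinuousCohomology_surjective ρ π hπ⟩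

/-- `H2DiscreteEquiv` is the comparison map. [cite: SerreGaloisCohomology1997, I §2.3] -/
@[simp] theorem H2DiscreteEquiv_apply (x : groupCohomology.H2 (Rep.of ρ)) :
    H2DiscreteEquiv ρ π hπ x = H2ToContinuousCohomology ρ π hπ x := rfl

/-- `H2DiscreteEquiv [f] = [f]`. [cite: SerreGaloisCohomology1997, I §2.3] -/
theorem H2DiscreteEquiv_H2π (f : cocycles₂ (Rep.of ρ)) :
    H2DiscreteEquiv ρ π hπ (H2π (Rep.of ρ) f) =
      twoCocycleClass (TopRep.of π) (cocycles₂ToContTwoCocycles ρ π hπ f) :=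
  H2ToContinuousCohomology_H2π ρ π hπ f

/-- The inverse sends the class of a continuous factor system to the class of the same cocycle.
[cite: SerreGaloisCohomology1997, I §2.3] -/
theorem H2DiscreteEquiv_symm_twoCocycleClass (c : contTwoCocycles (TopRep.of π)) :
    (H2DiscreteEquiv ρ π hπ).symm (twoCocycleClass (TopRep.of π) c) =
      H2π (Rep.of ρ) (contTwoCocyclesToCocycles₂ ρ π hπ c) := by
  apply (H2DiscreteEquiv ρ π hπ).injective
  rw [LinearEquiv.apply_symm_apply, H2DiscreteEquiv_H2π,
    cocycles₂ToContTwoCocycles_contTwoCocyclesToCocycles₂]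

/-- `addOrderOf` is preserved: the order of a class (e.g. of a fundamental class `u_{L/K}`) is the same
in both models. [cite: SerreGaloisCohomology1997, I §2.3] -/
theorem addOrderOf_H2DiscreteEquiv (x : groupCohomology.H2 (Rep.of ρ)) :
    addOrderOf (H2DiscreteEquiv ρ π hπ x) = addOrderOf x :=
  addOrderOf_injective (H2DiscreteEquiv ρ π hπ).toAddMonoidHom (H2DiscreteEquiv ρ π hπ).injective x

end Literature.NumberTheory.GaloisRepresentations
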